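import Summits.AtomisticToContinuum.HydrodynamicLimit.Theorems.InformationPercolationEngineKickFairRelEquilibriumMesoTransferCoreA
import Summits.AtomisticToContinuum.HydrodynamicLimit.Theorems.InformationPercolationEngineKickFairRelEquilibriumMesoCutCount

/-!
# `KickFairRelEquilibriumMeso`, line `Sketch` — glue T′ (rev 7/8, the SHORT-FLIGHT CUT), part 1: pointwise bounds,
# the kept level set, the core estimate

Helper file (`--supports stmt-AtomisticToContinuum-15177`) of the line lead for the registered glue stub
`stub_cutTransfer`. Rev ≤ 6 of the line transferred the UNBOUNDED windowed kick sum and paid the collision count at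
exponential scale under the invariant law (stub E1) — FALSE by the tight-necklace witness
(`Cruxes/KickFairRelEquilibriumMeso/NecklaceE1R2False.md`). Rev 7 cuts: weights that vanish on collisions preceded by
a flight of the sphere shorter than `t_N/A` (`hcut`). Then:

* `abs_slotSum_le_of_cut` — on the good set (with `|κ| ≤ C`), a cut weight family gives `|Z_{(t₁,t₂]}| ≤ 2C(A+1)·ε`
  for every window of length `≤ t_N` (at most `A+1` long-flight collisions per sphere, `stub_cutCount`);
* `abs_fullSum_sub_cut_le` — cutting a weight family changes the full kick sum by at most `2C ×` the normalised
  number of short-flight collisions (the functional of stub U);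
* `cut_kept_window_bound` — kept level set, one window: `∫_B |Z| dLG ≤ ((δ′+1/L)t_N + Λs(β+δ′t_N)e^{-c(N+1)}) LG(B)`
  from the bias/concentration conclusions of R-i″/R-ii″, ONE conditional transfer `LG → G₁` and the a.e. bound
  `|Z| ≤ β` — no count tail, no hot law;
* `cut_core_estimate` — the estimate at fixed `N` for a cut family: windows, energy cap (global domination + E2),
  level sets of the time-zero key (KC), kept (`cut_kept_window_bound`) / non-kept (`|Z| ≤ β`).
-/

noncomputable section

open MeasureTheory Set Filter Topology
open scoped ENNReal Classical

namespace Summit.AtomisticToContinuum.HydrodynamicLimit.Theorems.KickFairRelEquilibriumMesoLine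

open Literature.Analysis.FluidPDE Literature.MathematicalPhysics.KineticTheory
open Summit.AtomisticToContinuum.HydrodynamicLimit.Theorems

variable {σ : ℝ} {N : ℕ}

/-! ## Pointwise bounds for cut weight families -/

/-- A cut weight is dominated by the long-flight indicator: `|h i n p| ≤ 1{t_N/A ≤ flight(p)}`. [folklore] -/
theorem abs_le_longInd_of_cut {A : ℝ} {h : Fin (N + 1) → ℕ → Past N → ℝ} (hhb : ∀ i n p, |h i n p| ≤ 1)
    (hcut : ∀ i n p, p.2.2.2 - p.2.1 < tN N / A → h i n p = 0) (i : Fin (N + 1)) (n : ℕ) (p : Past N) :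
    |h i n p| ≤ (if tN N / A ≤ p.2.2.2 - p.2.1 then (1 : ℝ) else 0) := by
  split_ifs with hl
  · exact hhb i n p
  · rw [hcut i n p (not_le.1 hl), abs_zero]

/-- **On the good set, a cut weight family gives `|Z_{(t₁,t₂]}(z)| ≤ 2C(A+1)·ε`** for every window of length `≤ t_N`,
whenever `|g| ≤ C` and `|κ_{i,n}(z)| ≤ C` for all `i, n`: each sphere has at most `A+1` long-flight collisions in the
window (`stub_cutCount`). [folklore] -/
theorem abs_slotSum_le_of_cut (Φ : Flow σ N) (hσ : 0 < σ) (τ r : ℝ) {t₁ t₂ A : ℝ} (hA : 0 < A)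
    (hlen : t₂ ≤ t₁ + tN N) {g : V3 × V3 × V3 → ℝ} {C : ℝ} (hg : ∀ p, |g p| ≤ C)
    {h : Fin (N + 1) → ℕ → Past N → ℝ} (hhb : ∀ i n p, |h i n p| ≤ 1)
    (hcut : ∀ i n p, p.2.2.2 - p.2.1 < tN N / A → h i n p = 0)
    {z : Phase N} (hz : z ∈ Φ.good) (hκ : ∀ i : Fin (N + 1), ∀ n : ℕ, |kappa Φ r g i n z| ≤ C) :
    |slotSum Φ τ r t₁ t₂ g h z| ≤ 2 * C * (A + 1) * hsDiameter σ N := by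
  have hC : 0 ≤ C := (abs_nonneg _).trans (hg 0)
  have hε0 : 0 < hsDiameter σ N := hsDiameter_pos hσ N
  have hN0 : (0 : ℝ) < (N : ℝ) + 1 := by positivity
  have hε : 0 ≤ hsDiameter σ N / ((N : ℝ) + 1) := div_nonneg hε0.le hN0.le
  -- per sphere
  have hi : ∀ i : Fin (N + 1), |∑ n ∈ Finset.range (cnt Φ τ z i),
      (if t₁ < Φ.nthCollisionTimeOf i n z ∧ Φ.nthCollisionTimeOf i n z ≤ t₂ then (1 : ℝ) else 0) *
        (h i n (past Φ r z i n) * (g (kick Φ i n z) - kappa Φ r g i n z))| ≤ 2 * C * (A + 1) := by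
    intro i
    have hcc := stub_cutCount σ N Φ τ r A t₁ t₂ hA hlen z hz i
    refine (Finset.abs_sum_le_sum_abs _ _).trans ?_
    calc ∑ n ∈ Finset.range (cnt Φ τ z i),
          |(if t₁ < Φ.nthCollisionTimeOf i n z ∧ Φ.nthCollisionTimeOf i n z ≤ t₂ then (1 : ℝ) else 0) *
            (h i n (past Φ r z i n) * (g (kick Φ i n z) - kappa Φ r g i n z))|
        ≤ (∑ n ∈ Finset.range (cnt Φ τ z i),
            ((if t₁ < Φ.nthCollisionTimeOf i n z ∧ Φ.nthCollisionTimeOf i n z ≤ t₂ then (1 : ℝ) else 0) *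
              (if tN N / A ≤ (past Φ r z i n).2.2.2 - (past Φ r z i n).2.1 then (1 : ℝ) else 0))) * (2 * C) := by
          rw [Finset.sum_mul]
          refine Finset.sum_le_sum fun n _ => ?_
          rw [abs_mul, abs_mul]
          have h1 : |(if t₁ < Φ.nthCollisionTimeOf i n z ∧ Φ.nthCollisionTimeOf i n z ≤ t₂ then (1 : ℝ) else 0)| =
              (if t₁ < Φ.nthCollisionTimeOf i n z ∧ Φ.nthCollisionTimeOf i n z ≤ t₂ then (1 : ℝ) else 0) := by
            split_ifs <;> simp
          have h1' : 0 ≤ (if t₁ < Φ.nthCollisionTimeOf i n z ∧ Φ.nthCollisionTimeOf i n z ≤ t₂ then (1 : ℝ) else 0) := by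
            split_ifs <;> norm_num
          have h2 := abs_le_longInd_of_cut hhb hcut i n (past Φ r z i n)
          have h2' : 0 ≤ (if tN N / A ≤ (past Φ r z i n).2.2.2 - (past Φ r z i n).2.1 then (1 : ℝ) else 0) := by
            split_ifs <;> norm_num
          have h3 : |g (kick Φ i n z) - kappa Φ r g i n z| ≤ 2 * C :=
            (abs_sub _ _).trans (by linarith [hg (kick Φ i n z), hκ i n])
          rw [h1]
          calc _ ≤ (if t₁ < Φ.nthCollisionTimeOf i n z ∧ Φ.nthCollisionTimeOf i n z ≤ t₂ then (1 : ℝ) else 0) *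
                ((if tN N / A ≤ (past Φ r z i n).2.2.2 - (past Φ r z i n).2.1 then (1 : ℝ) else 0) * (2 * C)) :=
                mul_le_mul_of_nonneg_left (mul_le_mul h2 h3 (abs_nonneg _) h2') h1'
            _ = _ := by ring
      _ ≤ (A + 1) * (2 * C) := mul_le_mul_of_nonneg_right hcc (by positivity : (0 : ℝ) ≤ 2 * C)
      _ = 2 * C * (A + 1) := by ring
  unfold slotSum
  rw [abs_mul, abs_of_nonneg hε]
  calc hsDiameter σ N / ((N : ℝ) + 1) * |∑ i : Fin (N + 1), ∑ n ∈ Finset.range (cnt Φ τ z i),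
        (if t₁ < Φ.nthCollisionTimeOf i n z ∧ Φ.nthCollisionTimeOf i n z ≤ t₂ then (1 : ℝ) else 0) *
          (h i n (past Φ r z i n) * (g (kick Φ i n z) - kappa Φ r g i n z))|
      ≤ hsDiameter σ N / ((N : ℝ) + 1) * ∑ _i : Fin (N + 1), 2 * C * (A + 1) :=
        mul_le_mul_of_nonneg_left ((Finset.abs_sum_le_sum_abs _ _).trans (Finset.sum_le_sum fun i _ => hi i)) hε
    _ = 2 * C * (A + 1) * hsDiameter σ N := by
        rw [Finset.sum_const, Finset.card_univ, Fintype.card_fin, nsmul_eq_mul]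
        field_simp
        push_cast
        ring

/-- **Cutting changes the full kick sum by at most `2C ×` the normalised short-flight count**: if `h'` is the cut of `h`
(`h' i n p = h i n p` on long flights, `0` on short ones) and `|κ_{i,n}(z)| ≤ C` for all `i, n`, then
`|S_h(z) − S_{h'}(z)| ≤ 2C · (ε/(N+1)) Σ_i Σ_{n<cnt_i} 1{flight_{i,n} < t_N/A}`. [folklore] -/
theorem abs_fullSum_sub_cut_le (Φ : Flow σ N) (hσ : 0 < σ) (τ r : ℝ) {A : ℝ}
    {g : V3 × V3 × V3 → ℝ} {C : ℝ} (hg : ∀ p, |g p| ≤ C)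
    {h h' : Fin (N + 1) → ℕ → Past N → ℝ} (hhb : ∀ i n p, |h i n p| ≤ 1)
    (hrel : ∀ i n p, h' i n p = if tN N / A ≤ p.2.2.2 - p.2.1 then h i n p else 0)
    {z : Phase N} (hκ : ∀ i : Fin (N + 1), ∀ n : ℕ, |kappa Φ r g i n z| ≤ C) :
    |fullSum Φ τ r g h z - fullSum Φ τ r g h' z| ≤
      2 * C * (hsDiameter σ N / ((N : ℝ) + 1) * ∑ i : Fin (N + 1), ∑ n ∈ Finset.range (cnt Φ τ z i),
        (if (past Φ r z i n).2.2.2 - (past Φ r z i n).2.1 < tN N / A then (1 : ℝ) else 0)) := by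
  have hC : 0 ≤ C := (abs_nonneg _).trans (hg 0)
  have hε : 0 ≤ hsDiameter σ N / ((N : ℝ) + 1) := div_nonneg (hsDiameter_pos hσ N).le (by positivity)
  have hdiff : fullSum Φ τ r g h z - fullSum Φ τ r g h' z =
      hsDiameter σ N / ((N : ℝ) + 1) * ∑ i : Fin (N + 1), ∑ n ∈ Finset.range (cnt Φ τ z i),
        (h i n (past Φ r z i n) - h' i n (past Φ r z i n)) * (g (kick Φ i n z) - kappa Φ r g i n z) := by
    unfold fullSum
    rw [← mul_sub, ← Finset.sum_sub_distrib]
    congr 1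
    refine Finset.sum_congr rfl fun i _ => ?_
    rw [← Finset.sum_sub_distrib]
    refine Finset.sum_congr rfl fun n _ => ?_
    ring
  rw [hdiff, abs_mul, abs_of_nonneg hε, mul_left_comm]
  refine mul_le_mul_of_nonneg_left ?_ hε
  rw [Finset.mul_sum]
  refine (Finset.abs_sum_le_sum_abs _ _).trans (Finset.sum_le_sum fun i _ => ?_)
  rw [Finset.mul_sum]
  refine (Finset.abs_sum_le_sum_abs _ _).trans (Finset.sum_le_sum fun n _ => ?_)
  rw [abs_mul]
  have h1 : |h i n (past Φ r z i n) - h' i n (past Φ r z i n)| ≤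
      (if (past Φ r z i n).2.2.2 - (past Φ r z i n).2.1 < tN N / A then (1 : ℝ) else 0) := by
    rw [hrel i n]
    by_cases hl : tN N / A ≤ (past Φ r z i n).2.2.2 - (past Φ r z i n).2.1
    · rw [if_pos hl, if_neg (not_lt.2 hl), sub_self, abs_zero]
    · rw [if_neg hl, if_pos (not_le.1 hl), sub_zero]
      exact hhb i n _
  have h1' : 0 ≤ (if (past Φ r z i n).2.2.2 - (past Φ r z i n).2.1 < tN N / A then (1 : ℝ) else 0) := by
    split_ifs <;> norm_num
  have h3 : |g (kick Φ i n z) - kappa Φ r g i n z| ≤ 2 * C :=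
    (abs_sub _ _).trans (by linarith [hg (kick Φ i n z), hκ i n])
  calc |h i n (past Φ r z i n) - h' i n (past Φ r z i n)| * |g (kick Φ i n z) - kappa Φ r g i n z|
      ≤ (if (past Φ r z i n).2.2.2 - (past Φ r z i n).2.1 < tN N / A then (1 : ℝ) else 0) * (2 * C) :=
        mul_le_mul h1 h3 (abs_nonneg _) h1'
    _ = _ := by ring

/-- The cut of a measurable weight family is measurable, bounded by `1` and cut. [folklore] -/
theorem cut_admissible {A : ℝ} {h h' : Fin (N + 1) → ℕ → Past N → ℝ} (hh : ∀ i n, Measurable (h i n))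
    (hhb : ∀ i n p, |h i n p| ≤ 1)
    (hrel : ∀ i n p, h' i n p = if tN N / A ≤ p.2.2.2 - p.2.1 then h i n p else 0) :
    (∀ i n, Measurable (h' i n)) ∧ (∀ i n p, |h' i n p| ≤ 1) ∧
      (∀ i n p, p.2.2.2 - p.2.1 < tN N / A → h' i n p = 0) := by
  refine ⟨fun i n => ?_, fun i n p => ?_, fun i n p hp => ?_⟩
  · have heq : h' i n = fun p => if tN N / A ≤ p.2.2.2 - p.2.1 then h i n p else 0 := funext (hrel i n)
    rw [heq]
    refine Measurable.ite ?_ (hh i n) measurable_const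
    exact measurableSet_le measurable_const
      ((measurable_snd.snd.snd).sub measurable_snd.fst)
  · rw [hrel]; split_ifs
    · exact hhb i n p
    · simp
  · rw [hrel, if_neg (not_le.2 hp)]

/-! ## The kept level set, one window (cut version: no count tail) -/

section LevelSet

variable {Φ : Flow σ N} {a₀ θ₀ : T3 → ℝ} {u₀ : T3 → V3} {z₀ : Phase N}

local notation "μL" => localGibbsLaw σ a₀ u₀ θ₀ N Φ
local notation "νL" => localGibbsLaw σ (fun _ => (1 : ℝ)) (fun _ => (0 : V3)) (fun _ => (1 : ℝ)) N Φ
local notation "Bz" => keyLevel N z₀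

/-- **Kept level set, one window, cut version.** Under the bias and concentration conclusions of R-i″/R-ii″ for the
window `(t₁, t₂]` on the level set `Bz` (of `LG`-mass `≥ e^{-η(N+1)}`), ONE conditional transfer `LG → G₁` with
constant `Λs` and the a.e. bound `|Z| ≤ β` under `G₁`:
`∫_{Bz} |Z| dLG ≤ ((δ′ + 1/L) t_N + Λs (β + δ′ t_N) e^{-c(N+1)}) · LG(Bz)`. [folklore] -/
theorem cut_kept_window_bound (hPM : PastMeasurable) (hσ : 0 < σ) (hσ2 : σ ≤ 1 / 2)
    {τ : ℝ} {g : V3 × V3 × V3 → ℝ} (hg : Continuous g)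
    {h : Fin (N + 1) → ℕ → Past N → ℝ} (hh : ∀ i n, Measurable (h i n))
    {β : ℝ} (hβ : 0 ≤ β) (t₁ t₂ : ℝ)
    (hZβ : ∀ᵐ z ∂(νL), |slotSum Φ τ (rs N) t₁ t₂ g h z| ≤ β)
    {Λs : ℝ} (hΛs0 : 0 ≤ Λs)
    (TB1 : ∀ F : Phase N → ℝ≥0∞, Measurable F →
      (νL) Bz * ∫⁻ z in Bz, F z ∂(μL) ≤ ENNReal.ofReal Λs * (μL) Bz * ∫⁻ z in Bz, F z ∂(νL))
    {δ' L c η : ℝ} (hδ' : 0 < δ') (hL : 0 < L)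
    (hkept : ENNReal.ofReal (Real.exp (-(η * ((N : ℝ) + 1)))) ≤ (μL) Bz)
    (hbias : |∫ z in Bz, slotSum Φ τ (rs N) t₁ t₂ g h z ∂(νL)| ≤ δ' * tN N * ((νL) Bz).toReal)
    (hconc : (νL) (Bz ∩ {z | tN N / L < |slotSum Φ τ (rs N) t₁ t₂ g h z -
        ((νL) Bz).toReal⁻¹ * ∫ z in Bz, slotSum Φ τ (rs N) t₁ t₂ g h z ∂(νL)|}) ≤
      ENNReal.ofReal (Real.exp (-(c * ((N : ℝ) + 1)))) * (νL) Bz) :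
    ∫⁻ z in Bz, ENNReal.ofReal |slotSum Φ τ (rs N) t₁ t₂ g h z| ∂(μL) ≤
      (ENNReal.ofReal ((δ' + 1 / L) * tN N) +
        ENNReal.ofReal (Λs * (β + δ' * tN N) * Real.exp (-(c * ((N : ℝ) + 1))))) * (μL) Bz := by
  set μ : Measure (Phase N) := μL with hμdef
  set ν : Measure (Phase N) := νL with hνdef
  set Z : Phase N → ℝ := slotSum Φ τ (rs N) t₁ t₂ g h with hZdef
  haveI : IsProbabilityMeasure ν := isProbabilityMeasure_localGibbsLaw continuous_const continuous_const
    continuous_const (fun _ => one_pos) (fun _ => one_pos) hσ2 N Φ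
  have hμν : μ ≪ ν := localGibbsLaw_absolutelyContinuous_localGibbsLaw continuous_const continuous_const
    continuous_const (fun _ => one_pos) (fun _ => one_pos) a₀ u₀ θ₀ hσ2 N Φ
  have hgood : ∀ {ρ : Measure (Phase N)}, ρ Φ.goodᶜ = 0 → ∀ᵐ z ∂ρ, z ∈ Φ.good := fun h0 => mem_ae_iff.2 h0
  have hμg : μ Φ.goodᶜ = 0 := localGibbsLaw_compl_good_eq_zero Φ
  have hνg : ν Φ.goodᶜ = 0 := localGibbsLaw_compl_good_eq_zero Φ
  have hBzm : MeasurableSet Bz := measurableSet_keyLevel z₀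
  have htN0 := (tN_pos N).le
  -- masses
  have hμB0 : μ Bz ≠ 0 := fun h0 => by
    rw [h0, nonpos_iff_eq_zero, ENNReal.ofReal_eq_zero] at hkept
    exact absurd hkept (not_le.2 (Real.exp_pos _))
  have hνB0 : ν Bz ≠ 0 := fun h0 => hμB0 (hμν h0)
  have hνtop : ν Bz ≠ ⊤ := measure_ne_top _ _
  -- the conditional mean
  set mk : ℝ := (ν Bz).toReal⁻¹ * ∫ z in Bz, Z z ∂ν with hmk
  set t : ℝ := tN N / L with ht
  have ht0 : 0 ≤ t := div_nonneg htN0 hL.le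
  have hνBpos : 0 < (ν Bz).toReal := ENNReal.toReal_pos hνB0 hνtop
  have hmk_le : |mk| ≤ δ' * tN N := by
    rw [hmk, abs_mul, abs_inv, abs_of_pos hνBpos]
    calc (ν Bz).toReal⁻¹ * |∫ z in Bz, Z z ∂ν| ≤ (ν Bz).toReal⁻¹ * (δ' * tN N * (ν Bz).toReal) :=
          mul_le_mul_of_nonneg_left hbias (inv_nonneg.2 hνBpos.le)
      _ = δ' * tN N := by field_simp
  -- measurable modification
  set ZG : Phase N → ℝ := slotSumGood Φ τ (rs N) t₁ t₂ g h with hZG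
  have hZGm : Measurable ZG := measurable_slotSumGood hPM hσ Φ τ (rs N) _ _ hg hh
  have hZZG : ∀ {ρ : Measure (Phase N)}, ρ Φ.goodᶜ = 0 → ∀ᵐ z ∂ρ, Z z = ZG z := fun hρ =>
    (hgood hρ).mono fun z hz => slotSum_eq_slotSumGood_of_mem_good Φ τ (rs N) _ _ g h hz
  set ppG : Phase N → ℝ := fun z => max (|ZG z - mk| - t) 0 with hppG
  have hppGm : Measurable fun z => ENNReal.ofReal (ppG z) :=
    ((((hZGm.sub measurable_const).abs).sub measurable_const).max measurable_const).ennreal_ofReal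
  set E' : Set (Phase N) := {z | t < |ZG z - mk|} with hE'
  have hE'm : MeasurableSet E' := measurableSet_lt measurable_const ((hZGm.sub measurable_const).abs)
  -- pointwise: |Z| ≤ (δ' + 1/L) tN + pp
  have hpt : ∀ᵐ z ∂μ, ENNReal.ofReal |Z z| ≤ ENNReal.ofReal ((δ' + 1 / L) * tN N) + ENNReal.ofReal (ppG z) := by
    filter_upwards [hZZG hμg] with z hz
    rw [← ENNReal.ofReal_add (mul_nonneg (by positivity) htN0) (le_max_right _ _)]
    refine ENNReal.ofReal_le_ofReal ?_
    rw [hz]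
    have h1 : |ZG z| ≤ |ZG z - mk| + |mk| := by
      calc |ZG z| = |(ZG z - mk) + mk| := by ring_nf
        _ ≤ |ZG z - mk| + |mk| := abs_add_le _ _
    have hmax : |ZG z - mk| ≤ t + max (|ZG z - mk| - t) 0 := by
      rcases le_or_gt (|ZG z - mk| - t) 0 with h0 | h0
      · rw [max_eq_right h0]; linarith
      · rw [max_eq_left h0.le]; linarith
    have heq : (δ' + 1 / L) * tN N = δ' * tN N + t := by rw [ht]; ring
    rw [heq]; linarith
  have hstep1 : ∫⁻ z in Bz, ENNReal.ofReal |Z z| ∂μ ≤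
      ENNReal.ofReal ((δ' + 1 / L) * tN N) * μ Bz + ∫⁻ z in Bz, ENNReal.ofReal (ppG z) ∂μ := by
    calc ∫⁻ z in Bz, ENNReal.ofReal |Z z| ∂μ
        ≤ ∫⁻ z in Bz, ENNReal.ofReal ((δ' + 1 / L) * tN N) + ENNReal.ofReal (ppG z) ∂μ :=
          lintegral_mono_ae (ae_restrict_of_ae hpt)
      _ = ENNReal.ofReal ((δ' + 1 / L) * tN N) * μ Bz + ∫⁻ z in Bz, ENNReal.ofReal (ppG z) ∂μ := by
          rw [lintegral_add_left measurable_const, setLIntegral_const, mul_comm]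
  -- the excess under ν lives on the deviation event and is bounded there by β + δ' tN
  have hppν : ∫⁻ z in Bz, ENNReal.ofReal (ppG z) ∂ν ≤ ENNReal.ofReal (β + δ' * tN N) * ν (Bz ∩ E') := by
    have hpp_le : ∀ᵐ z ∂ν, ENNReal.ofReal (ppG z) ≤ E'.indicator (fun _ => ENNReal.ofReal (β + δ' * tN N)) z := by
      filter_upwards [hZZG hνg, hZβ] with z hz hzβ
      by_cases hzE : z ∈ E'
      · rw [indicator_of_mem hzE]
        refine ENNReal.ofReal_le_ofReal ?_
        have h1 : max (|ZG z - mk| - t) 0 ≤ |ZG z - mk| := max_le (by linarith) (abs_nonneg _)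
        have h2 : |ZG z - mk| ≤ |ZG z| + |mk| := abs_sub _ _
        have h3 : |ZG z| ≤ β := by rw [← hz]; exact hzβ
        show max (|ZG z - mk| - t) 0 ≤ _
        linarith
      · rw [indicator_of_notMem hzE]
        have : ppG z = 0 := by
          simp only [hE', mem_setOf_eq, not_lt] at hzE
          exact max_eq_right (by linarith)
        rw [this, ENNReal.ofReal_zero]
    calc ∫⁻ z in Bz, ENNReal.ofReal (ppG z) ∂ν
        ≤ ∫⁻ z in Bz, E'.indicator (fun _ => ENNReal.ofReal (β + δ' * tN N)) z ∂ν :=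
          lintegral_mono_ae (ae_restrict_of_ae hpp_le)
      _ = ENNReal.ofReal (β + δ' * tN N) * ν (Bz ∩ E') := by
          rw [lintegral_indicator hE'm, Measure.restrict_restrict hE'm, inter_comm, setLIntegral_const]
  -- the concentration event under ν
  have hE'ν : ν (Bz ∩ E') ≤ ENNReal.ofReal (Real.exp (-(c * ((N : ℝ) + 1)))) * ν Bz := by
    have hsets : (Bz ∩ E' : Set (Phase N)) =ᵐ[ν]
        (Bz ∩ {z | tN N / L < |Z z - mk|} : Set (Phase N)) := by
      refine (ae_eq_refl _).inter ?_
      filter_upwards [hZZG hνg] with z hz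
      show (t < |ZG z - mk|) = (tN N / L < |Z z - mk|)
      rw [hz, ht]
    rw [measure_congr hsets]
    exact hconc
  -- transfer μ → ν and cancel ν(Bz)
  have hX1 := TB1 _ hppGm
  have hXμ : ∫⁻ z in Bz, ENNReal.ofReal (ppG z) ∂μ ≤
      ENNReal.ofReal (Λs * (β + δ' * tN N) * Real.exp (-(c * ((N : ℝ) + 1)))) * μ Bz := by
    have h1 : ν Bz * ∫⁻ z in Bz, ENNReal.ofReal (ppG z) ∂μ ≤
        (ENNReal.ofReal Λs * ENNReal.ofReal (β + δ' * tN N) *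
          ENNReal.ofReal (Real.exp (-(c * ((N : ℝ) + 1)))) * μ Bz) * ν Bz := by
      calc ν Bz * ∫⁻ z in Bz, ENNReal.ofReal (ppG z) ∂μ
          ≤ ENNReal.ofReal Λs * μ Bz * ∫⁻ z in Bz, ENNReal.ofReal (ppG z) ∂ν := hX1
        _ ≤ ENNReal.ofReal Λs * μ Bz * (ENNReal.ofReal (β + δ' * tN N) *
              (ENNReal.ofReal (Real.exp (-(c * ((N : ℝ) + 1)))) * ν Bz)) :=
            mul_le_mul_right (hppν.trans (mul_le_mul_right hE'ν _)) _
        _ = _ := by ring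
    refine (cancel_mass hνB0 hνtop h1).trans (le_of_eq ?_)
    rw [← ENNReal.ofReal_mul hΛs0, ← ENNReal.ofReal_mul (mul_nonneg hΛs0 (add_nonneg hβ (mul_nonneg hδ'.le htN0)))]
  calc ∫⁻ z in Bz, ENNReal.ofReal |Z z| ∂μ
      ≤ ENNReal.ofReal ((δ' + 1 / L) * tN N) * μ Bz +
          ENNReal.ofReal (Λs * (β + δ' * tN N) * Real.exp (-(c * ((N : ℝ) + 1)))) * μ Bz :=
        hstep1.trans (add_le_add_right hXμ _)
    _ = _ := by ring

end LevelSet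

/-- **Registered sub-goal `cutAdmissible` of the glue T′ (part 1)**: the cut of an admissible weight family is
admissible and cut — a binder-free corollary of `cut_admissible` recorded for the gate. [folklore] -/
theorem cutAdmissible : ∀ (N : ℕ) (A : ℝ) (h h' : Fin (N + 1) → ℕ → Past N → ℝ),
    (∀ i n, Measurable (h i n)) → (∀ i n p, |h i n p| ≤ 1) →
    (∀ i n p, h' i n p = if tN N / A ≤ p.2.2.2 - p.2.1 then h i n p else 0) →
    (∀ i n, Measurable (h' i n)) ∧ (∀ i n p, |h' i n p| ≤ 1) ∧
      (∀ i n p, p.2.2.2 - p.2.1 < tN N / A → h' i n p = 0) :=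
  fun _ _ _ _ hh hhb hrel => cut_admissible hh hhb hrel

end Summit.AtomisticToContinuum.HydrodynamicLimit.Theorems.KickFairRelEquilibriumMesoLine

end
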